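import Mathlib
import Summits.NavierStokesRegularity.NavierStokesRegularity.Theorems.SubOnsagerCeilingSideBranchChainDrive
import Summits.NavierStokesRegularity.NavierStokesRegularity.Theorems.SubOnsagerCeilingSideBranchLiveBalance
import HarnessLib

/-!
# Route SubOnsagerCeiling — the POCKET CHOKES THE SIDE BRANCH of `α_SB`
# (helper file for item stmt-NavierStokesRegularity-25507 `OrthantTailCeiling`; `--supports`; def-free)

Brick of the ENGINE for the escape construction behind the negative lemmas of the aside crux
`OrthantTailCeiling` / `ForwardTailCeiling` on the side-branch dead-end table `α_SB`
(`…/Negative/OrthantTailCeilingFalseOfSideBranchCeilingEscape.lean`: the cruxes are false as soon as,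
for each candidate ceiling `(θ, C)`, ONE block `0..K` loses more than `C E₀ b^{-2θ(K+1)}` along the
non-negative CEILING-OBEYING regular solutions).  What such an escape needs is a SPLIT ESTIMATE: of the
energy leaving the chain mode `x_k`, the side unit (side mode `s_k` plus its dead-end pocket `z_{k+1}`)
must not take everything.  This file proves the split estimate AFTER THE POCKET HAS CHOKED THE SIDE MODE:

* `sideBranch_choke_comparison` — calculus: on `[t₀,t₁]`, if `y' ≥ F − d·y`, `y ≥ 0`, and
  `s' ≤ κF − d'·s` with `d ≤ d'`, `κ ≥ 0`, then `s(t) ≤ s(t₀)e^{−d'(t−t₀)} + κ·y(t)` (comparison function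
  `(s − κy − s(t₀)e^{−d'(t−t₀)})·e^{d'(t−t₀)}`, no integrals);
* `sideBranch_choke_capture` — accumulation: if moreover `G_s' ≤ L·F·s`, `G_y' ≥ F·y`, `0 ≤ F ≤ a`,
  `s(t₀) ≥ 0`, `d' > 0`, then `G_s(t₁) − G_s(t₀) ≤ Lκ·(G_y(t₁) − G_y(t₀)) + L·a·s(t₀)/d'`;
* `sideBranch_side_choked` — the `α_SB` instance: along a regular `ν`-viscous solution on `[0,s]`, on a
  window `[t₀,t₁] ⊆ [0,s]` where `s_k, x_{k+1} ≥ 0`, the receivers of `x_{k+1}` are small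
  (`x_{k+2}, s_{k+1} ≤ ρ`) and the pocket is already filled to a level `z_{k+1} ≥ ζ` with
  `(6/5)Λ_{k+1}ρ + ν_{k+1} ≤ (1/5)Λ_k ζ + ν_k` (the CHOKE CONDITION), the side mode obeys
  `s_k(t) ≤ s_k(t₀)e^{−(Λ_kζ/5+ν_k)(t−t₀)} + x_{k+1}(t)/5`: apart from an exponentially dying memory it
  is at most ONE FIFTH of the chain receiver (both are fed by `x_k²`, the side with coefficient `1/5`,
  and the choked side mode relaxes at least as fast as the chain receiver);
* `sideBranch_split_after_choke` — consequence: on such a window with `Λ_k x_k² ≤ a`, the side unit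
  `½s_k² + ½z_{k+1}²` grows by at most `1/25` of the growth of the escaped energy
  `A_k = −B_k + ½s_k²` (`B_k` the block energy, `A_k' ≥ Λ_k x_k² x_{k+1}`, file …SideBranchLiveBalance)
  plus the memory `(a/5)·s_k(t₀)/(Λ_kζ/5 + ν_k)`.

Under a `(θ,C)` ceiling the receivers are small for free (`ρ = √(2CE₀)·b^{-θ(k+1)}`), so the choke
condition is a FILL LEVEL `ζ_k ≍ b^{5/2}√(2CE₀) b^{-θ(k+1)}` of the pocket; what is NOT done here is the
pre-choke phase (how much the side unit takes before `z_{k+1}` reaches `ζ_k`).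

HONEST FRAMING: elementary real analysis of a Tao-type MODEL lattice ODE (route SubOnsagerCeiling, rung
TL-M2Break); bricks toward a construction that is NOT carried out here; nothing bears on Navier–Stokes
regularity; no crux is settled here. [cite: Tao2016AveragedNS, §4 (4.2)–(4.3)];
Katz–Pavlović couplings: [cite: BarbatoMorandinRomito2011, §2].
-/

noncomputable section

-- the sub-problem namespace `NavierStokesRegularity.NavierStokesRegularity` is the tree's layout (D-0017)
set_option linter.dupNamespace false

namespace Summit.NavierStokesRegularity.NavierStokesRegularity.Theorems.SubOnsagerCeiling

open Set
open Literature.Analysis.FluidPDE.TaoCascade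

/-! ## Two pieces of calculus on a window `[t₀, t₁]` -/

/-- **Choke comparison.** On `[t₀,t₁]`: if `y' = f_y ≥ F − d·y` with `y ≥ 0`, and
`s' = f_s ≤ κ·F − d'·s` with `d ≤ d'` and `κ ≥ 0`, then `s(t) ≤ s(t₀)·e^{−d'(t−t₀)} + κ·y(t)`.
(Comparison function `w = s − κy − s(t₀)e^{−d'(t−t₀)}`: `w' ≤ −d'w`, `w(t₀) ≤ 0`.) [folklore] -/
theorem sideBranch_choke_comparison {y s f_y f_s F : ℝ → ℝ} {t₀ t₁ d d' κ : ℝ} (hdd : d ≤ d')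
    (hκ : 0 ≤ κ)
    (hy : ∀ u ∈ Icc t₀ t₁, HasDerivWithinAt y (f_y u) (Icc t₀ t₁) u)
    (hs : ∀ u ∈ Icc t₀ t₁, HasDerivWithinAt s (f_s u) (Icc t₀ t₁) u)
    (hfy : ∀ u ∈ Icc t₀ t₁, F u - d * y u ≤ f_y u)
    (hfs : ∀ u ∈ Icc t₀ t₁, f_s u ≤ κ * F u - d' * s u)
    (hy0 : ∀ u ∈ Icc t₀ t₁, 0 ≤ y u) {t : ℝ} (ht : t ∈ Icc t₀ t₁) :
    s t ≤ s t₀ * Real.exp (-(d' * (t - t₀))) + κ * y t := by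
  -- `Φ(u) = (s u − κ y u) e^{d'(u−t₀)} − s t₀` is non-increasing
  set Φ : ℝ → ℝ := fun u => (s u - κ * y u) * Real.exp (d' * (u - t₀)) with hΦ
  have hderΦ : ∀ u ∈ Icc t₀ t₁, HasDerivWithinAt Φ
      ((f_s u - κ * f_y u + d' * (s u - κ * y u)) * Real.exp (d' * (u - t₀))) (Icc t₀ t₁) u := by
    intro u hu
    have h1 : HasDerivWithinAt (fun u => s u - κ * y u) (f_s u - κ * f_y u) (Icc t₀ t₁) u :=
      (hs u hu).sub ((hy u hu).const_mul κ)
    have h2 : HasDerivWithinAt (fun x => Real.exp (d' * (x - t₀)))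
        (Real.exp (d' * (u - t₀)) * (d' * 1)) (Icc t₀ t₁) u :=
      (((hasDerivAt_id' u).sub_const t₀).const_mul d').exp.hasDerivWithinAt
    refine (h1.mul h2).congr_deriv ?_
    ring
  -- `−Φ` has non-negative derivative
  have hderΨ : ∀ u ∈ Icc t₀ t₁, HasDerivWithinAt (fun u => -Φ u)
      (-((f_s u - κ * f_y u + d' * (s u - κ * y u)) * Real.exp (d' * (u - t₀)))) (Icc t₀ t₁) u :=
    fun u hu => (hderΦ u hu).neg
  have hpos : ∀ u ∈ Icc t₀ t₁,
      0 ≤ -((f_s u - κ * f_y u + d' * (s u - κ * y u)) * Real.exp (d' * (u - t₀))) := by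
    intro u hu
    have h1 := hfs u hu
    have h2 := hfy u hu
    have h3 := hy0 u hu
    have h4 : κ * (F u - d * y u) ≤ κ * f_y u := mul_le_mul_of_nonneg_left h2 hκ
    have h5 : 0 ≤ κ * ((d' - d) * y u) := mul_nonneg hκ (mul_nonneg (by linarith) h3)
    have h6 : f_s u - κ * f_y u + d' * (s u - κ * y u) ≤ 0 := by nlinarith
    have h7 := Real.exp_pos (d' * (u - t₀))
    nlinarith
  have hmono := sideBranch_le_of_deriv_nonneg hderΨ hpos ht
  simp only [hΦ, sub_self, mul_zero, Real.exp_zero, mul_one, neg_le_neg_iff] at hmono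
  -- unfold: `(s t − κ y t) e^{d'(t−t₀)} ≤ s t₀ − κ y t₀ ≤ s t₀`
  have hE : 0 < Real.exp (d' * (t - t₀)) := Real.exp_pos _
  have hy00 : 0 ≤ y t₀ := hy0 t₀ (left_mem_Icc.2 (ht.1.trans ht.2))
  have h1 : (s t - κ * y t) * Real.exp (d' * (t - t₀)) ≤ s t₀ := by nlinarith
  have h2 : s t - κ * y t ≤ s t₀ * Real.exp (-(d' * (t - t₀))) := by
    rw [Real.exp_neg, ← div_eq_mul_inv, le_div_iff₀ hE]
    exact h1
  linarith

/-- **Choked capture (accumulation).** On `[t₀,t₁]`: if `G_s' ≤ L·F·s`, `G_y' ≥ F·y` with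
`0 ≤ F ≤ a`, `L, κ ≥ 0`, and `s ≤ s(t₀)e^{−d'(·−t₀)} + κ y` there with `s(t₀) ≥ 0`, `d' > 0`, then
`G_s(t₁) − G_s(t₀) ≤ L·κ·(G_y(t₁) − G_y(t₀)) + L·a·s(t₀)/d'`. (Comparison function
`Lκ G_y − G_s − (L a s(t₀)/d') e^{−d'(u−t₀)}`, no integrals.) [folklore] -/
theorem sideBranch_choke_capture {y s G_s G_s' G_y G_y' F : ℝ → ℝ} {t₀ t₁ d' κ L a : ℝ}
    (hd' : 0 < d') (hL : 0 ≤ L) (hκ : 0 ≤ κ)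
    (hGs : ∀ u ∈ Icc t₀ t₁, HasDerivWithinAt G_s (G_s' u) (Icc t₀ t₁) u)
    (hGy : ∀ u ∈ Icc t₀ t₁, HasDerivWithinAt G_y (G_y' u) (Icc t₀ t₁) u)
    (hGs' : ∀ u ∈ Icc t₀ t₁, G_s' u ≤ L * F u * s u)
    (hGy' : ∀ u ∈ Icc t₀ t₁, F u * y u ≤ G_y' u)
    (hF0 : ∀ u ∈ Icc t₀ t₁, 0 ≤ F u) (hFa : ∀ u ∈ Icc t₀ t₁, F u ≤ a)
    (hcmp : ∀ u ∈ Icc t₀ t₁, s u ≤ s t₀ * Real.exp (-(d' * (u - t₀))) + κ * y u)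
    (hs0 : 0 ≤ s t₀) (ht : t₀ ≤ t₁) :
    G_s t₁ - G_s t₀ ≤ L * κ * (G_y t₁ - G_y t₀) + L * a * s t₀ / d' := by
  set c : ℝ := L * a * s t₀ / d' with hc
  set Ψ : ℝ → ℝ := fun u => L * κ * G_y u - G_s u - c * Real.exp (-(d' * (u - t₀))) with hΨ
  have hderΨ : ∀ u ∈ Icc t₀ t₁, HasDerivWithinAt Ψ
      (L * κ * G_y' u - G_s' u - c * (Real.exp (-(d' * (u - t₀))) * (-(d' * 1)))) (Icc t₀ t₁) u := by
    intro u hu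
    have h1 : HasDerivWithinAt (fun x => Real.exp (-(d' * (x - t₀))))
        (Real.exp (-(d' * (u - t₀))) * (-(d' * 1))) (Icc t₀ t₁) u :=
      (((hasDerivAt_id' u).sub_const t₀).const_mul d').neg.exp.hasDerivWithinAt
    exact (((hGy u hu).const_mul (L * κ)).sub (hGs u hu)).sub (h1.const_mul c)
  have hpos : ∀ u ∈ Icc t₀ t₁,
      0 ≤ L * κ * G_y' u - G_s' u - c * (Real.exp (-(d' * (u - t₀))) * (-(d' * 1))) := by
    intro u hu
    have h1 := hGs' u hu
    have h2 := hGy' u hu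
    have h3 := hF0 u hu
    have h4 := hFa u hu
    have h5 := hcmp u hu
    have hE := Real.exp_pos (-(d' * (u - t₀)))
    -- `L F s ≤ L F (s₀ e + κ y) ≤ L a s₀ e + L κ F y ≤ c d' e + L κ G_y'`
    have h6 : L * F u * s u ≤ L * F u * (s t₀ * Real.exp (-(d' * (u - t₀))) + κ * y u) :=
      mul_le_mul_of_nonneg_left h5 (mul_nonneg hL h3)
    have h7 : L * F u * (s t₀ * Real.exp (-(d' * (u - t₀)))) ≤
        L * a * (s t₀ * Real.exp (-(d' * (u - t₀)))) :=
      mul_le_mul_of_nonneg_right (mul_le_mul_of_nonneg_left h4 hL) (mul_nonneg hs0 hE.le)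
    have h8 : L * κ * (F u * y u) ≤ L * κ * G_y' u := mul_le_mul_of_nonneg_left h2 (mul_nonneg hL hκ)
    have h9 : c * (Real.exp (-(d' * (u - t₀))) * (-(d' * 1))) =
        -(L * a * (s t₀ * Real.exp (-(d' * (u - t₀))))) := by
      rw [hc]; field_simp
    rw [h9]
    nlinarith
  have hmono := sideBranch_le_of_deriv_nonneg hderΨ hpos (right_mem_Icc.2 ht)
  simp only [hΨ, sub_self, mul_zero, neg_zero, Real.exp_zero, mul_one] at hmono
  have hE : 0 < Real.exp (-(d' * (t₁ - t₀))) := Real.exp_pos _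
  have hc0 : 0 ≤ c := by rw [hc]; exact div_nonneg (mul_nonneg (mul_nonneg hL (le_trans
    (hF0 t₀ (left_mem_Icc.2 ht)) (hFa t₀ (left_mem_Icc.2 ht)))) hs0) hd'.le
  have h3 : 0 ≤ c * Real.exp (-(d' * (t₁ - t₀))) := mul_nonneg hc0 hE.le
  linarith


/-! ## The pocket chokes the side branch of `α_SB` -/

section Solution

variable {ε₀ ν s : ℝ} {X : Fin 4 → ℤ → ℝ → ℝ}

/-- **The choked side mode of `α_SB`.** Along a regular solution of the `ν`-viscous `α_SB` lattice on
`[0,s]`, let `[t₀,t₁] ⊆ [0,s]` and suppose on `[t₀,t₁]`: `s_k ≥ 0`, `x_{k+1} ≥ 0`, the receivers of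
`x_{k+1}` are small, `x_{k+2} ≤ ρ`, `s_{k+1} ≤ ρ`, and the pocket is filled, `z_{k+1} ≥ ζ`, to a level
satisfying the CHOKE CONDITION `(6/5)Λ_{k+1}ρ + ν_{k+1} ≤ (1/5)Λ_k ζ + ν_k`.  Then
`s_k(t) ≤ s_k(t₀)·e^{−(Λ_kζ/5 + ν_k)(t−t₀)} + x_{k+1}(t)/5` on `[t₀,t₁]`
(`Λ_n = (1+ε₀)^{5n/2}`, `ν_n = ν(1+ε₀)^{2n}`; equations `ṡ_k = (1/5)Λ_k(x_k² − s_k z_{k+1}) − ν_k s_k`,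
`ẋ_{k+1} = Λ_k x_k² − Λ_{k+1}x_{k+1}(x_{k+2} + s_{k+1}/5) − ν_{k+1}x_{k+1}`). [this file] -/
theorem sideBranch_side_choked (hε : 0 < ε₀)
    (hder : ∀ (i : Fin 4) (k : ℤ), ∀ t ∈ Icc (0 : ℝ) s, HasDerivWithinAt (X i k)
      (quadTerm ε₀ sideBranchTable X i k t - ν * (1 + ε₀) ^ ((2 : ℝ) * k) * X i k t)
      (Icc (0 : ℝ) s) t)
    (k : ℤ) {t₀ t₁ ρ ζ : ℝ} (ht₀ : 0 ≤ t₀) (ht₁ : t₁ ≤ s)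
    (hsk : ∀ u ∈ Icc t₀ t₁, 0 ≤ X 1 k u)
    (hy0 : ∀ u ∈ Icc t₀ t₁, 0 ≤ X 0 (k + 1) u)
    (hx2 : ∀ u ∈ Icc t₀ t₁, X 0 (k + 1 + 1) u ≤ ρ)
    (hs1 : ∀ u ∈ Icc t₀ t₁, X 1 (k + 1) u ≤ ρ)
    (hz : ∀ u ∈ Icc t₀ t₁, ζ ≤ X 2 (k + 1) u)
    (hchoke : (6 / 5 : ℝ) * (1 + ε₀) ^ ((5 : ℝ) * ((k + 1 : ℤ) : ℝ) / 2) * ρ +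
        ν * (1 + ε₀) ^ ((2 : ℝ) * ((k + 1 : ℤ) : ℝ)) ≤
      (1 / 5 : ℝ) * (1 + ε₀) ^ ((5 : ℝ) * k / 2) * ζ + ν * (1 + ε₀) ^ ((2 : ℝ) * k))
    {t : ℝ} (ht : t ∈ Icc t₀ t₁) :
    X 1 k t ≤ X 1 k t₀ * Real.exp (-(((1 / 5 : ℝ) * (1 + ε₀) ^ ((5 : ℝ) * k / 2) * ζ +
        ν * (1 + ε₀) ^ ((2 : ℝ) * k)) * (t - t₀))) + (1 / 5 : ℝ) * X 0 (k + 1) t := by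
  have hb : (0 : ℝ) < 1 + ε₀ := by linarith
  set Λ : ℝ := (1 + ε₀) ^ ((5 : ℝ) * k / 2) with hΛ
  set Λ₁ : ℝ := (1 + ε₀) ^ ((5 : ℝ) * ((k + 1 : ℤ) : ℝ) / 2) with hΛ₁
  set c₀ : ℝ := ν * (1 + ε₀) ^ ((2 : ℝ) * k) with hc₀
  set c₁ : ℝ := ν * (1 + ε₀) ^ ((2 : ℝ) * ((k + 1 : ℤ) : ℝ)) with hc₁
  have hΛ0 : 0 < Λ := Real.rpow_pos_of_pos hb _
  have hΛ₁0 : 0 < Λ₁ := Real.rpow_pos_of_pos hb _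
  set d : ℝ := (6 / 5 : ℝ) * Λ₁ * ρ + c₁ with hd
  set d' : ℝ := (1 / 5 : ℝ) * Λ * ζ + c₀ with hd'
  have hsub : Icc t₀ t₁ ⊆ Icc (0 : ℝ) s := Icc_subset_Icc ht₀ ht₁
  -- the two equations within the window
  have hy : ∀ u ∈ Icc t₀ t₁, HasDerivWithinAt (X 0 (k + 1))
      (quadTerm ε₀ sideBranchTable X 0 (k + 1) u - c₁ * X 0 (k + 1) u) (Icc t₀ t₁) u :=
    fun u hu => (hder 0 (k + 1) u (hsub hu)).mono hsub
  have hs : ∀ u ∈ Icc t₀ t₁, HasDerivWithinAt (X 1 k)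
      (quadTerm ε₀ sideBranchTable X 1 k u - c₀ * X 1 k u) (Icc t₀ t₁) u :=
    fun u hu => (hder 1 k u (hsub hu)).mono hsub
  have hfeed : (1 + ε₀) ^ ((5 : ℝ) * (((k + 1 : ℤ) : ℝ) - 1) / 2) = Λ := by
    rw [hΛ]; push_cast; ring_nf
  -- chain receiver: `ẋ_{k+1} ≥ Λ x_k² − d x_{k+1}`
  have hfy : ∀ u ∈ Icc t₀ t₁, Λ * X 0 k u ^ 2 - d * X 0 (k + 1) u ≤
      quadTerm ε₀ sideBranchTable X 0 (k + 1) u - c₁ * X 0 (k + 1) u := by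
    intro u hu
    rw [sideBranch_quadTerm_zero, hfeed, ← hΛ₁, add_sub_cancel_right]
    have hyu := hy0 u hu
    have h1 : X 0 (k + 1) u * X 0 (k + 1 + 1) u ≤ X 0 (k + 1) u * ρ :=
      mul_le_mul_of_nonneg_left (hx2 u hu) hyu
    have h2 : X 0 (k + 1) u * X 1 (k + 1) u ≤ X 0 (k + 1) u * ρ :=
      mul_le_mul_of_nonneg_left (hs1 u hu) hyu
    have h4 : Λ₁ * (X 0 (k + 1) u * X 0 (k + 1 + 1) u) ≤ Λ₁ * (X 0 (k + 1) u * ρ) :=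
      mul_le_mul_of_nonneg_left h1 hΛ₁0.le
    have h5 : (1 / 5 : ℝ) * Λ₁ * (X 0 (k + 1) u * X 1 (k + 1) u) ≤
        (1 / 5 : ℝ) * Λ₁ * (X 0 (k + 1) u * ρ) := mul_le_mul_of_nonneg_left h2 (by positivity)
    have h6 : d * X 0 (k + 1) u = Λ₁ * (X 0 (k + 1) u * ρ) + (1 / 5 : ℝ) * Λ₁ * (X 0 (k + 1) u * ρ) +
        c₁ * X 0 (k + 1) u := by rw [hd]; ring
    linarith
  -- side mode: `ṡ_k ≤ (1/5)Λ x_k² − d' s_k`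
  have hfs : ∀ u ∈ Icc t₀ t₁, quadTerm ε₀ sideBranchTable X 1 k u - c₀ * X 1 k u ≤
      (1 / 5 : ℝ) * (Λ * X 0 k u ^ 2) - d' * X 1 k u := by
    intro u hu
    rw [sideBranch_quadTerm_one, ← hΛ]
    have h1 : X 1 k u * ζ ≤ X 1 k u * X 2 (k + 1) u := mul_le_mul_of_nonneg_left (hz u hu) (hsk u hu)
    have h2 : (1 / 5 : ℝ) * Λ * (X 1 k u * ζ) ≤ (1 / 5 : ℝ) * Λ * (X 1 k u * X 2 (k + 1) u) :=
      mul_le_mul_of_nonneg_left h1 (by positivity)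
    have h3 : d' * X 1 k u = (1 / 5 : ℝ) * Λ * (X 1 k u * ζ) + c₀ * X 1 k u := by rw [hd']; ring
    linarith
  have hdd : d ≤ d' := hchoke
  have := sideBranch_choke_comparison hdd (by norm_num : (0 : ℝ) ≤ 1 / 5) hy hs hfy hfs hy0 ht
  simpa only [hd'] using this

/-- **The split estimate after the choke.** In the situation of `sideBranch_side_choked` (`ν > 0`, no
shells below `0`, `k : ℕ`, `ζ ≥ 0`, `t₀ ≤ t₁`), suppose moreover `Λ_k x_k² ≤ a` on `[t₀,t₁]`.  Then the SIDE UNIT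
`U_k = ½s_k² + ½z_{k+1}²` and the ESCAPED ENERGY `A_k = −B_k + ½s_k²`
(`B_k = Σ_{j ≤ k} Σ_i ½X_{i,j}²`; `A_k' ≥ Λ_k x_k² x_{k+1}`, …SideBranchLiveBalance) satisfy
`U_k(t₁) − U_k(t₀) ≤ (1/25)·(A_k(t₁) − A_k(t₀)) + (a/5)·s_k(t₀)/(Λ_kζ/5 + ν_k)`:
after the choke the side unit takes at most one twenty-fifth of what escapes, plus a memory term.
[this file] -/
theorem sideBranch_split_after_choke (hε : 0 < ε₀) (hν : 0 < ν)
    (hlow : ∀ (i : Fin 4) (k : ℤ), k < 0 → ∀ t : ℝ, X i k t = 0)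
    (hder : ∀ (i : Fin 4) (k : ℤ), ∀ t ∈ Icc (0 : ℝ) s, HasDerivWithinAt (X i k)
      (quadTerm ε₀ sideBranchTable X i k t - ν * (1 + ε₀) ^ ((2 : ℝ) * k) * X i k t)
      (Icc (0 : ℝ) s) t)
    (k : ℕ) {t₀ t₁ ρ ζ a : ℝ} (ht₀ : 0 ≤ t₀) (ht₀₁ : t₀ ≤ t₁) (ht₁ : t₁ ≤ s)
    (hsk : ∀ u ∈ Icc t₀ t₁, 0 ≤ X 1 (k : ℤ) u)
    (hy0 : ∀ u ∈ Icc t₀ t₁, 0 ≤ X 0 ((k : ℤ) + 1) u)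
    (hx2 : ∀ u ∈ Icc t₀ t₁, X 0 ((k : ℤ) + 1 + 1) u ≤ ρ)
    (hs1 : ∀ u ∈ Icc t₀ t₁, X 1 ((k : ℤ) + 1) u ≤ ρ)
    (hz : ∀ u ∈ Icc t₀ t₁, ζ ≤ X 2 ((k : ℤ) + 1) u)
    (hchoke : (6 / 5 : ℝ) * (1 + ε₀) ^ ((5 : ℝ) * (((k : ℤ) + 1 : ℤ) : ℝ) / 2) * ρ +
        ν * (1 + ε₀) ^ ((2 : ℝ) * (((k : ℤ) + 1 : ℤ) : ℝ)) ≤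
      (1 / 5 : ℝ) * (1 + ε₀) ^ ((5 : ℝ) * ((k : ℤ) : ℝ) / 2) * ζ + ν * (1 + ε₀) ^ ((2 : ℝ) * ((k : ℤ) : ℝ)))
    (hζ : 0 ≤ ζ)
    (hxa : ∀ u ∈ Icc t₀ t₁, (1 + ε₀) ^ ((5 : ℝ) * ((k : ℤ) : ℝ) / 2) * X 0 (k : ℤ) u ^ 2 ≤ a) :
    ((1 / 2 : ℝ) * X 1 (k : ℤ) t₁ ^ 2 + (1 / 2 : ℝ) * X 2 ((k : ℤ) + 1) t₁ ^ 2) -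
        ((1 / 2 : ℝ) * X 1 (k : ℤ) t₀ ^ 2 + (1 / 2 : ℝ) * X 2 ((k : ℤ) + 1) t₀ ^ 2) ≤
      (1 / 25 : ℝ) *
          ((-(∑ j ∈ Finset.range (k + 1), ∑ i : Fin 4, (1 / 2 : ℝ) * X i (j : ℤ) t₁ ^ 2) +
              (1 / 2 : ℝ) * X 1 (k : ℤ) t₁ ^ 2) -
            (-(∑ j ∈ Finset.range (k + 1), ∑ i : Fin 4, (1 / 2 : ℝ) * X i (j : ℤ) t₀ ^ 2) +
              (1 / 2 : ℝ) * X 1 (k : ℤ) t₀ ^ 2)) +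
        (1 / 5 : ℝ) * a * X 1 (k : ℤ) t₀ /
          ((1 / 5 : ℝ) * (1 + ε₀) ^ ((5 : ℝ) * ((k : ℤ) : ℝ) / 2) * ζ +
            ν * (1 + ε₀) ^ ((2 : ℝ) * ((k : ℤ) : ℝ))) := by
  have hb : (0 : ℝ) < 1 + ε₀ := by linarith
  set K : ℤ := (k : ℤ) with hK
  set Λ : ℝ := (1 + ε₀) ^ ((5 : ℝ) * (K : ℝ) / 2) with hΛ
  set c₀ : ℝ := ν * (1 + ε₀) ^ ((2 : ℝ) * (K : ℝ)) with hc₀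
  set c₁ : ℝ := ν * (1 + ε₀) ^ ((2 : ℝ) * ((K + 1 : ℤ) : ℝ)) with hc₁
  have hΛ0 : 0 < Λ := Real.rpow_pos_of_pos hb _
  have hc₀0 : 0 < c₀ := mul_pos hν (Real.rpow_pos_of_pos hb _)
  have hc₁0 : 0 ≤ c₁ := (mul_pos hν (Real.rpow_pos_of_pos hb _)).le
  set d' : ℝ := (1 / 5 : ℝ) * Λ * ζ + c₀ with hd'
  have hsub : Icc t₀ t₁ ⊆ Icc (0 : ℝ) s := Icc_subset_Icc ht₀ ht₁
  -- the choke comparison on the window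
  have hcmp : ∀ u ∈ Icc t₀ t₁, X 1 K u ≤ X 1 K t₀ * Real.exp (-(d' * (u - t₀))) +
      (1 / 5 : ℝ) * X 0 (K + 1) u :=
    fun u hu => sideBranch_side_choked hε hder K ht₀ ht₁ hsk hy0 hx2 hs1 hz hchoke hu
  have hd'0 : 0 < d' := by
    have h1 : 0 ≤ (1 / 5 : ℝ) * Λ * ζ := by positivity
    rw [hd']; linarith
  -- the side unit `U = ½s_k² + ½z_{k+1}²` and its derivative
  set U : ℝ → ℝ := fun u => (1 / 2 : ℝ) * X 1 K u ^ 2 + (1 / 2 : ℝ) * X 2 (K + 1) u ^ 2 with hU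
  set U' : ℝ → ℝ := fun u =>
    X 1 K u * (quadTerm ε₀ sideBranchTable X 1 K u - c₀ * X 1 K u) +
      X 2 (K + 1) u * (quadTerm ε₀ sideBranchTable X 2 (K + 1) u - c₁ * X 2 (K + 1) u) with hU'
  have hderU : ∀ u ∈ Icc t₀ t₁, HasDerivWithinAt U (U' u) (Icc t₀ t₁) u := by
    intro u hu
    have h1 := (((hder 1 K u (hsub hu)).mono hsub).pow 2).const_mul (1 / 2 : ℝ)
    have h2 := (((hder 2 (K + 1) u (hsub hu)).mono hsub).pow 2).const_mul (1 / 2 : ℝ)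
    refine (h1.add h2).congr_deriv ?_
    simp only [hU', hc₀, hc₁]
    push_cast
    ring
  have hU'le : ∀ u ∈ Icc t₀ t₁, U' u ≤ (1 / 5 : ℝ) * (Λ * X 0 K u ^ 2) * X 1 K u := by
    intro u hu
    simp only [hU']
    rw [sideBranch_quadTerm_one, sideBranch_quadTerm_two_succ, ← hΛ]
    have h1 : 0 ≤ c₀ * X 1 K u ^ 2 := mul_nonneg hc₀0.le (sq_nonneg _)
    have h2 : 0 ≤ c₁ * X 2 (K + 1) u ^ 2 := mul_nonneg hc₁0 (sq_nonneg _)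
    nlinarith
  -- the escaped energy `A = −B_k + ½s_k²` and its derivative (…SideBranchLiveBalance)
  set A : ℝ → ℝ := fun w => -(∑ j ∈ Finset.range (k + 1), ∑ i : Fin 4,
    (1 / 2 : ℝ) * X i (j : ℤ) w ^ 2) + (1 / 2 : ℝ) * X 1 (k : ℤ) w ^ 2 with hA
  set A' : ℝ → ℝ := fun u => botSum ε₀ sideBranchTable X (k : ℤ) u +
    (∑ j ∈ Finset.range (k + 1), ∑ i : Fin 4,
      ν * (1 + ε₀) ^ ((2 : ℝ) * ((j : ℤ) : ℝ)) * X i (j : ℤ) u ^ 2) +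
    X 1 (k : ℤ) u * (quadTerm ε₀ sideBranchTable X 1 (k : ℤ) u -
      ν * (1 + ε₀) ^ ((2 : ℝ) * ((k : ℤ) : ℝ)) * X 1 (k : ℤ) u) with hA'
  have hderA : ∀ u ∈ Icc t₀ t₁, HasDerivWithinAt A (A' u) (Icc t₀ t₁) u := fun u hu =>
    (sideBranch_liveBlock_hasDerivWithinAt hlow hder k (hsub hu)).mono hsub
  have hA'ge : ∀ u ∈ Icc t₀ t₁, (Λ * X 0 K u ^ 2) * X 0 (K + 1) u ≤ A' u := by
    intro u hu
    have h := sideBranch_liveBlock_deriv_ge (X := X) hε hν.le k (hsk u hu)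
    simpa only [hA', hΛ, hK, mul_assoc] using h
  have hF0 : ∀ u ∈ Icc t₀ t₁, 0 ≤ Λ * X 0 K u ^ 2 := fun u _ => by positivity
  have hs0 : 0 ≤ X 1 K t₀ := hsk t₀ (left_mem_Icc.2 ht₀₁)
  have hmain := sideBranch_choke_capture (G_s := U) (G_y := A) hd'0 (by norm_num : (0 : ℝ) ≤ 1 / 5)
    (by norm_num : (0 : ℝ) ≤ 1 / 5) hderU hderA hU'le hA'ge hF0 hxa hcmp hs0 ht₀₁
  simp only [hU, hA] at hmain
  have h25 : (1 / 5 : ℝ) * (1 / 5) = 1 / 25 := by norm_num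
  rw [h25] at hmain
  exact hmain

end Solution

end Summit.NavierStokesRegularity.NavierStokesRegularity.Theorems.SubOnsagerCeiling

end
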